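import Literature.IUT.HodgeTheaters.ThetaHodgeTheaters
import Literature.IUT.HodgeTheaters.PlaceKitBridge
import Literature.IUT.HodgeTheaters.ThetaHodgeTheatersCor56iSubProofs
import HarnessLib

/-!
# The §3 ↔ §5 dictionary (MERGE-MAP C9-i, adapter C1): abc-iut-L5-t2's `HodgeTheaterModel D` ↦ abc-iut-L5-t4's
# `ℱ`-prime-strip kit `FKit` over a place kit indexed by `V̲` (hypothesis structure + constructor)

S. Mochizuki, *Inter-universal Teichmüller theory I*, kurims manuscript (May 2020): Examples 3.2 (i), (iii), (vi),
3.3 (i), (iii), 3.4 (i), (ii), 3.5 (ii) pp. 69–86 (the reference data `ℱ̲_v ↦ 𝒟_v, ℱ^⊢_v`, `𝔉^⊩_mod`), Definition 3.6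
p. 87 (Θ-Hodge theaters), Definition 5.2 (i)–(iv) pp. 134–135 ("`‡ℱ_v` is a category `‡𝒞_v` which admits an
equivalence `‡𝒞_v ⥲ 𝒞_v` [where `𝒞_v` is as in Examples 3.2, (iii); 3.3, (i)]"), Remark 5.2.1 (i), (ii) p. 143 (the
functorial algorithms `𝔉 ↦ 𝔇`, `𝔉 ↦ 𝔉^⊢`, `𝔉 ↦ 𝔉^⊩`), Definition 6.1 (i) p. 156, the proof of Corollary 5.6 (i)
p. 154 l. 13–16 ("for `v ∈ 𝕍^good`, one verifies immediately that `†ℱ_{>,v} = †ℱ̲_v`")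
([IUTchI] Def 5.2 (i) p.134) [claim: Mochizuki2012, status: disputed] (D-0012 claim key, series status DISPUTED —
this file is a DICTIONARY between two landed typings of the cell; nothing of the series is asserted and no side is
taken on [IUTchIII] Cor. 3.12).

## Why this file exists (plan/L6/MERGE-MAP.md §4 C9-i; HOME/staging/L5/L5-t4/KIT-INSTANCE-SPEC.md §3, adapter C1)

abc-iut-L5-t2 typed [IUTchI] §3 (Examples 3.2–3.5, Def 3.6) as the INTERFACE `HodgeTheaterModel D` over an initial
Θ-datum `D` (`ThetaHodgeTheaters.lean`: groupoids `Loc v` (kind of `ℱ̲_v`), `BaseFull v` (kind of `𝒟_v`), `Dash v` (kind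
of `ℱ^⊢_v`), `Glob` (kind of `𝔉^⊩_mod`), functors `baseFullOf`, `dashOf`, `component`, …); abc-iut-L5-t4 typed [IUTchI]
§5 as the kit `PMBaseKit.FKit` over a base kit (`FPrimeStrips.lean`: slots `FAmb/fModel/toD`, `FmAmb/toFm`,
`RlfAmb/rlfFm/rlfOf`, `ThAmb/thToF`, `toDm`), and landed the place kit `InitialThetaData.PlaceKit D` whose index set IS
`V̲` (`PlaceKitBridge.lean`).  The two have the SAME SHAPE and no dictionary between them existed (KIT-INSTANCE-SPEC §0:
"MISSING: §3↔§5 dictionary").  This file supplies it: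

* `HodgeTheaterModel.FKitLink Mo T M` — a HYPOTHESIS STRUCTURE over `Mo : HodgeTheaterModel D`, a place kit
  `T : D.PlaceKit` and a multiplicative kit `M` of `T.kit`, whose fields are exactly the printed passages §3 → §5 that
  `HodgeTheaterModel` does not carry: (a) Def 5.2 (i)(a) / Ex 3.2 (iii): the kind `LocC x` of `ℱ_v = 𝒞_v` with the
  passage `ℱ̲_v ↦ 𝒞_v` (`cOf`; the `p_v`-adic Frobenioid "subcategory of Frobenius-trivial objects" of the tempered
  Frobenioid at `v ∈ 𝕍^bad`; an EQUIVALENCE off `𝕍^bad` — "for `v ∈ 𝕍^good`, `†ℱ_{>,v} = †ℱ̲_v`", Cor 5.6 proof p. 154),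
  its base `𝒞_v ↦ 𝒟_v` (`cBase`, with `ℱ̲_v ↦ 𝒞_v ↦ 𝒟_v` = t2's `baseFullOf`) and mono-analyticisation `𝒞_v ↦ ℱ^⊢_v`
  (`cDash`, with `ℱ̲_v ↦ 𝒞_v ↦ ℱ^⊢_v` = t2's `dashOf`); (b) Def 6.1 (i)/(ii) vs Ex 3.2 (i): the isomorphs of `𝒟_v` of
  §3 are objects of the kit's ambient category — a fully faithful `baseAmb x : Mo.BaseFull v ⥤ T.kit.Amb x` carrying
  `𝒟_v` to the kit's model (the one genuinely cross-kit field; it is `KitCore.amb` for t2's `BaseFull`); (c) Rmk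
  5.2.1 (ii): the realification functor `𝔉 ↦ 𝔉^⊩` (`rlfOf`, `rlfOfMap`, `rlfFm_rlfOf` — t2's interface deliberately
  omits Example 3.5's construction; KIT-INSTANCE-SPEC adapter C2); (d) Def 4.1 (iii)/(iv): families of §3 base data `𝒟^⊢_v` are
  `𝒟^⊢`-prime-strips of the multiplicative kit (`dmOf`, `dmOfMap`), compatibly with mono-analyticisation on both sides
  (`dmOf_compat` — the "(iii) mono link" B1 of KIT-INSTANCE-SPEC §2).  No field asserts a result of the series.
* `FKitLink.toFKit : T.kit.FKit M` — the CONSTRUCTOR: `FAmb := LocC`, `fModel := cOf ℱ̲_v`, `toD := cBase ⋙ baseAmb`,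
  `FmAmb := Dash`, `toFm := cDash`, `RlfAmb := Glob`, `rlfModel := 𝔉^⊩_mod`, `rlfFm := component`, `ThAmb := Loc`,
  `thModel := ℱ̲_v`, `thToF := cOf`, `toDm := dmOf ∘ base` (with `toDm_toFm` DERIVED from t2's `baseCompat`).
* Consequences for plan/L5/SUBDAG-IUTchI-Cor56i.md, stated (proof side to follow in a companion): under the link,
  abc-iut-w5-d217's row L02 `ThToFBijOnGood` is `cOf` being an equivalence off `𝕍^bad` (field `cOf_isEquivalence`), and
  row L03 (`RlfIsoFaithful` / `RlfIsoLifts`) becomes the two LAWS of the realification functor `rlfOf` (adapter C2).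

typed ≠ proved; a KIT-RULE inhabitant of `FKitLink` is owed as a companion.
-/

namespace Literature.IUT.HodgeTheaters

open CategoryTheory

universe uK u v w

section Link

variable {F : Type u} {K : Type v} {Fbar : Type w} [Field F] [NumberField F] [Field K]
  [NumberField K] [Algebra F K] [Field Fbar] [Algebra F Fbar] [Algebra K Fbar]
  {E : WeierstrassCurve F} [E.IsElliptic] {l : ℕ} {P : BadPlacePredicates K}
  {D : InitialThetaData F K Fbar E l P}

namespace HodgeTheaterModel

/-- **`FKitLink(Mo, T, M)` — the §3 ↔ §5 dictionary** (MERGE-MAP C9-i, adapter C1): the printed passages from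
abc-iut-L5-t2's reference data of Examples 3.2–3.5 (`HodgeTheaterModel D`) to the slots of abc-iut-L5-t4's
`ℱ`-prime-strip kit over a place kit `T` indexed by `V̲`, one field per passage (see the module docstring for the
locators).  A HYPOTHESIS STRUCTURE (no field asserts a result of the series).
([IUTchI] Def 5.2 (i) p.134) [claim: Mochizuki2012, status: disputed] -/
structure FKitLink (Mo : HodgeTheaterModel.{u, v, w, uK} D) (T : InitialThetaData.PlaceKit.{uK} D)
    (M : T.kit.MultKit) where
  /-- Def 5.2 (i)(a): the kind (groupoid of isomorphs) of `ℱ_v = 𝒞_v`, "`𝒞_v` as in Examples 3.2, (iii); 3.3, (i)"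
  (at `v ∈ 𝕍^bad` the `p_v`-adic Frobenioid inside the tempered Frobenioid `ℱ̲_v`; at good `v` the kind of `ℱ̲_v`
  itself), indexed by the kit's copy of `V̲` -/
  LocC : T.kit.V → Type uK
  /-- groupoid structure on `LocC x` -/
  [locCGpd : ∀ x, Groupoid.{uK} (LocC x)]
  /-- Ex 3.2 (iii) / Cor 5.6 proof p. 154: the passage `ℱ̲_v ↦ ℱ_v` ("the subcategory of Frobenius-trivial objects"
  at bad `v`; "`†ℱ_{>,v} = †ℱ̲_v`" at good `v`) … -/
  cOf : ∀ x, Mo.Loc (T.e x) ⥤ LocC x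
  /-- … which is an equivalence of kinds off `𝕍^bad` ("for `v ∈ 𝕍^good`, one verifies immediately that
  `†ℱ_{>,v} = †ℱ̲_v`", p. 154 l. 13–16) -/
  cOf_isEquivalence : ∀ x, x ∉ T.kit.bad → (cOf x).IsEquivalence
  /-- Rmk 5.2.1 (i): `ℱ_v ↦ 𝒟_v`, the base category of the Frobenioid `𝒞_v` (Ex 3.2 (iii): "base category `𝒟_v`") … -/
  cBase : ∀ x, LocC x ⥤ Mo.BaseFull (T.e x)
  /-- … with `ℱ̲_v ↦ 𝒞_v ↦ 𝒟_v` = abc-iut-L5-t2's `ℱ̲_v ↦ 𝒟_v` (`baseFullOf`, Ex 3.2 (vi)(d), 3.3 (iii)(c)) -/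
  cBase_comp : ∀ x, cOf x ⋙ cBase x ≅ Mo.baseFullOf (T.e x)
  /-- Rmk 5.2.1 (ii): `ℱ_v ↦ ℱ^⊢_v` (mono-analyticisation of the local datum) … -/
  cDash : ∀ x, LocC x ⥤ Mo.Dash (T.e x)
  /-- … with `ℱ̲_v ↦ 𝒞_v ↦ ℱ^⊢_v` = abc-iut-L5-t2's `dashOf` (Ex 3.2 (vi)(f), 3.3 (iii)(e), 3.4 (ii)) -/
  cDash_comp : ∀ x, cOf x ⋙ cDash x ≅ Mo.dashOf (T.e x)
  /-- Def 6.1 (i)/(ii) vs Ex 3.2 (i): the isomorphs of `𝒟_v` of §3 (objects of `Mo.BaseFull v`) ARE objects of the kit's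
  ambient category at the corresponding index … -/
  baseAmb : ∀ x, Mo.BaseFull (T.e x) ⥤ T.kit.Amb x
  /-- … with the same morphisms (fully faithful) … -/
  baseAmbFF : ∀ x, (baseAmb x).FullyFaithful
  /-- … the model `𝒟_v` (base of the reference `ℱ̲_v`) going to the kit's model `𝒟_v`. -/
  baseAmb_model : ∀ x, (baseAmb x).obj ((Mo.baseFullOf (T.e x)).obj (Mo.Fref (T.e x))) ≅ T.kit.model x
  /-- Rmk 5.2.1 (ii) / Ex 3.5 (i), (ii): the functorial algorithm `𝔉 ↦ 𝔉^⊩` on objects (the realification slot that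
  abc-iut-L5-t2's interface omits; KIT-INSTANCE-SPEC adapter C2) … -/
  rlfOf : (∀ x, LocC x) → Mo.Glob
  /-- … on isomorphisms … -/
  rlfOfMap : ∀ {F₁ F₂ : ∀ x, LocC x}, (∀ x, F₁ x ≅ F₂ x) → (rlfOf F₁ ≅ rlfOf F₂)
  /-- … and its `v̲`-components: the `ℱ^⊢`-prime-strip inside `𝔉^⊩` is the mono-analyticisation of `𝔉`
  (Rmk 5.2.1 (ii) "consisting of … the `ℱ^⊢`-prime-strip `‡𝔉^⊢`"). -/
  rlfFm_rlfOf : ∀ (G : ∀ x, LocC x) (x), (Mo.component (T.e x)).obj (rlfOf G) ≅ (cDash x).obj (G x)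
  /-- Def 4.1 (iii)/(iv) vs Ex 3.2 (vi)(a), 3.3 (iii)(a), 3.4 (ii): families of §3 base data `𝒟^⊢_v` (kind `Mo.Base v`)
  ARE `𝒟^⊢`-prime-strips of the multiplicative kit, on objects … -/
  dmOf : (∀ x, Mo.Base (T.e x)) → M.DMono
  /-- … and on isomorphisms … -/
  dmOfMap : ∀ {G₁ G₂ : ∀ x, Mo.Base (T.e x)}, (∀ x, G₁ x ≅ G₂ x) → (dmOf G₁ ⟶ dmOf G₂)
  /-- … compatibly with mono-analyticisation on both sides (the "(iii) mono link" B1 of KIT-INSTANCE-SPEC §2): for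
  a family of isomorphs of the `𝒟_v`, abc-iut-L5-t2's `𝒟_v ↦ 𝒟^⊢_v` (`dashOfBase`, Ex 3.2 (vi)(a)) read in the
  multiplicative kit agrees with the kit's `𝔇 ↦ 𝔇^⊢` (`M.mono`, Def 4.1 (iv)) applied to the family read in the
  base kit through `baseAmb`. -/
  dmOf_compat : ∀ (G : ∀ x, Mo.BaseFull (T.e x))
      (hG : ∀ x, Nonempty (G x ≅ (Mo.baseFullOf (T.e x)).obj (Mo.Fref (T.e x)))),
    Nonempty (dmOf (fun x => (Mo.dashOfBase (T.e x)).obj (G x)) ⟶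
      M.mono ⟨fun x => (baseAmb x).obj (G x), fun x => ⟨(baseAmb x).mapIso (hG x).some ≪≫ baseAmb_model x⟩⟩)

attribute [instance] FKitLink.locCGpd

namespace FKitLink

variable {Mo : HodgeTheaterModel.{u, v, w, uK} D} {T : InitialThetaData.PlaceKit.{uK} D} {M : T.kit.MultKit}
  (L : Mo.FKitLink T M)

/-- **The constructor `FKitLink ↦ FKit`** (adapter C1): abc-iut-L5-t4's `ℱ`-prime-strip kit over the place kit `T`
READ OFF abc-iut-L5-t2's reference data through the link — `ℱ_v`-data of kind `LocC` with model `𝒞_v = cOf(ℱ̲_v)` and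
base `𝔉 ↦ 𝔇 := cBase ⋙ baseAmb`; `ℱ^⊢_v`-data of kind `Dash` with `𝔉 ↦ 𝔉^⊢ := cDash`; `𝔉^⊩`-data of kind `Glob` with model
`𝔉^⊩_mod`, components `component v` and realification `rlfOf`; Def 3.6 local data of kind `Loc` with model `ℱ̲_v` and
`ℱ̲_v ↦ ℱ_v := cOf`; `𝔉^⊢ ↦ 𝔇^⊢ := dmOf ∘ base`, the compatibility `𝔉 ↦ 𝔉^⊢ ↦ 𝔇^⊢ = 𝔉 ↦ 𝔇 ↦ 𝔇^⊢`
DERIVED from abc-iut-L5-t2's law `baseCompat` and the link's `dmOf_compat`. ([IUTchI] Def 5.2 (i) p.134) [claim: Mochizuki2012, status: disputed] -/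
noncomputable def toFKit : T.kit.FKit M where
  FAmb := L.LocC
  fModel x := (L.cOf x).obj (Mo.Fref (T.e x))
  FmAmb x := Mo.Dash (T.e x)
  fmModel x := (Mo.dashOf (T.e x)).obj (Mo.Fref (T.e x))
  toD x := L.cBase x ⋙ L.baseAmb x
  toD_model x := (L.baseAmb x).mapIso ((L.cBase_comp x).app (Mo.Fref (T.e x))) ≪≫ L.baseAmb_model x
  toFm := L.cDash
  toFm_model x := (L.cDash_comp x).app (Mo.Fref (T.e x))
  RlfAmb := Mo.Glob
  rlfModel := Mo.FmodRef
  rlfFm x := Mo.component (T.e x)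
  rlfOf := L.rlfOf
  rlfOfMap := L.rlfOfMap
  rlfFm_rlfOf := L.rlfFm_rlfOf
  ThAmb x := Mo.Loc (T.e x)
  thModel x := Mo.Fref (T.e x)
  thToF := L.cOf
  thToF_model _ := Iso.refl _
  toDm G := L.dmOf fun x => (Mo.base (T.e x)).obj (G x)
  toDmMap φ := L.dmOfMap fun x => (Mo.base (T.e x)).mapIso (φ x)
  toDm_toFm G hG := by
    -- `𝔉 ↦ 𝔉^⊢ ↦ 𝔇^⊢` vs `𝔉 ↦ 𝔇 ↦ 𝔇^⊢`: through abc-iut-L5-t2's `baseCompat` (the two routes `ℱ̲_v ↦ 𝒟_v ↦ 𝒟^⊢_v`,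
    -- `ℱ̲_v ↦ ℱ^⊢_v ↦ 𝒟^⊢_v` agree) at the reference object, transported along `hG`, then `dmOf_compat`
    have hG' : ∀ x, Nonempty ((L.cBase x).obj (G x) ≅ (Mo.baseFullOf (T.e x)).obj (Mo.Fref (T.e x))) := fun x =>
      ⟨(L.cBase x).mapIso (hG x).some ≪≫ (L.cBase_comp x).app (Mo.Fref (T.e x))⟩
    obtain ⟨m⟩ := L.dmOf_compat (fun x => (L.cBase x).obj (G x)) hG'
    refine ⟨L.dmOfMap (fun x => ?_) ≫ m⟩
    exact (Mo.base (T.e x)).mapIso ((L.cDash x).mapIso (hG x).some ≪≫ (L.cDash_comp x).app (Mo.Fref (T.e x))) ≪≫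
      (Mo.baseCompat (T.e x)).symm.app (Mo.Fref (T.e x)) ≪≫
      (Mo.dashOfBase (T.e x)).mapIso (((L.cBase_comp x).app (Mo.Fref (T.e x))).symm ≪≫
        (L.cBase x).mapIso (hG x).some.symm)

/-- Under the link, abc-iut-L5-t2's Θ-Hodge theaters (Def 3.6 over `HodgeTheaterModel`) ARE structured Θ-Hodge
theaters of the constructed kit: local data `{†ℱ̲_v}`, global datum `†𝔉^⊩_mod`, compatibility `component_iso`
composed with `cDash_comp` (Def 3.6 (c): "`†ℱ^⊢_v` is as discussed in (a), (b)").
([IUTchI] Def 3.6 p.87) [claim: Mochizuki2012, status: disputed] -/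
noncomputable def thetaHT (HT : ThetaHodgeTheater Mo) : L.toFKit.ThetaHT where
  th x := HT.loc (T.e x)
  th_isModel x := HT.loc_iso (T.e x)
  rlf := HT.glob
  rlf_isModel := HT.glob_iso
  rlf_fm x := HT.component_iso (T.e x) ≪≫ ((L.cDash_comp x).app (HT.loc (T.e x))).symm

/-- **Row L02 of plan/L5/SUBDAG-IUTchI-Cor56i.md from the link**: for the constructed kit, abc-iut-w5-d217's
`ThToFBijOnGood` ("for `v ∈ 𝕍^good`, … `†ℱ_{>,v} = †ℱ̲_v`", Cor 5.6 proof p. 154 l. 13–16) HOLDS — it is the field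
`cOf_isEquivalence` (an equivalence of kinds is fully faithful). ([IUTchI] Cor 5.6 (i) p.154) [claim: Mochizuki2012, status: disputed] -/
theorem thToFBijOnGood : L.toFKit.ThToFBijOnGood :=
  PMBaseKit.FKit.thToFBijOnGood_of_fullyFaithful fun x hx => by
    haveI := L.cOf_isEquivalence x hx
    exact Functor.FullyFaithful.ofFullyFaithful (L.cOf x)

/-- Under the link, an isomorphism of abc-iut-L5-t2's Θ-Hodge theaters (Rmk 3.6.2: `locIso`, `globIso`, `comm`) IS an
isomorphism of the corresponding structured Θ-Hodge theaters of the kit (`thIso := locIso`, `rlfIso := globIso`; the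
kit's compatibility follows from t2's `comm` and the naturality of `cDash_comp`).
([IUTchI] Cor 5.6 (i) p.153) [claim: Mochizuki2012, status: disputed] -/
noncomputable def thetaHTIso {HT HT' : ThetaHodgeTheater Mo} (φ : ThetaHodgeTheater.Iso HT HT') :
    PMBaseKit.FKit.ThetaHT.Iso (L.thetaHT HT) (L.thetaHT HT') where
  thIso x := φ.locIso (T.e x)
  rlfIso := φ.globIso
  compat x := by
    have hc := congrArg Iso.hom (φ.comm (T.e x))
    simp only [Iso.trans_hom, Functor.mapIso_hom] at hc
    have hn := (L.cDash_comp x).inv.naturality (φ.locIso (T.e x)).hom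
    simp only [Functor.comp_map] at hn
    change (Mo.component (T.e x)).map φ.globIso.hom ≫
        (HT'.component_iso (T.e x) ≪≫ ((L.cDash_comp x).app (HT'.loc (T.e x))).symm).hom =
      (HT.component_iso (T.e x) ≪≫ ((L.cDash_comp x).app (HT.loc (T.e x))).symm).hom ≫
        (L.cDash x).map ((L.cOf x).map (φ.locIso (T.e x)).hom)
    rw [Iso.trans_hom, Iso.trans_hom, Iso.symm_hom, Iso.symm_hom, Iso.app_inv, Iso.app_inv, ← Category.assoc, hc,
      Category.assoc, Category.assoc, hn]
    rfl


end FKitLink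

end HodgeTheaterModel

end Link

end Literature.IUT.HodgeTheaters
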